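import Mathlib
import Summits.Ventures.HodgeRepro.Tier4.Line1.RTFSetting
import Summits.Ventures.HodgeRepro.Tier4.Line1.SpectralOfRTF
import Summits.Ventures.HodgeRepro.Tier4.Line1.RtfGeometric
import Summits.Ventures.HodgeRepro.Tier4.Line1.DefinedContentOfData
import Summits.Ventures.HodgeRepro.Tier4.Common.AdelicRTF
import Summits.Ventures.HodgeRepro.Tier4.Common.AdelicHaar
import Summits.Ventures.HodgeRepro.Tier4.Common.L1Convolution
import Summits.Ventures.HodgeRepro.Tier4.Line1.SecondCountableGA
import Summits.Ventures.HodgeRepro.Tier4.Line1.SigmaCompactGA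
import Summits.Ventures.HodgeRepro.Tier4.Common.CompactOpenLevel
import Summits.Ventures.HodgeRepro.Tier4.Common.PseudoCoeff
import Summits.Ventures.HodgeRepro.Tier4.Common.MixedPlaneCusp
import Summits.Ventures.HodgeRepro.Tier4.Line4.ConvProduct
import Summits.Ventures.HodgeRepro.Tier4.Line4.TorusProduct
import Summits.Ventures.HodgeRepro.Tier4.Line4.FinitePlacePositivity
import Summits.Ventures.HodgeRepro.Tier4.Line4.ProjectedSupport
import Summits.Ventures.HodgeRepro.Tier4.Line4.W3TwoVectorHit
import Summits.Ventures.HodgeRepro.Tier4.Line4.W3TwoVector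
import Summits.Ventures.HodgeRepro.Tier4.Line4.W4SpectralBridge
import Summits.Ventures.HodgeRepro.Tier4.Line4.GeometricBridge
import Summits.Ventures.HodgeRepro.Tier4.Line4.W3OfRieszType
import Summits.Ventures.HodgeRepro.Tier4.Line4.ConjStability
import Summits.Ventures.HodgeRepro.Tier4.Line4.AdmissibleOfONB
import Summits.Ventures.HodgeRepro.Tier4.Line4.LowestOfPseudoCoeff
import Summits.Ventures.HodgeRepro.Tier4.Line4.KTypeOfPeriodClosed
import Summits.Ventures.HodgeRepro.Tier4.Line4.ThetaRungs
import Summits.Ventures.HodgeRepro.Tier4.Line4.AdaptedONBConj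
import Summits.Ventures.HodgeRepro.Tier4.Line4.ConjSpanLemmas
import Summits.Ventures.HodgeRepro.Tier4.Line4.MaximalFamilyClosed
import Summits.Ventures.HodgeRepro.Tier4.Line4.L1Class

/-!
# Tier4/Line4/L1ClassWall — v0.33 ASSEMBLY, second half: Layer A (the `L¹` twin of 2VEC-HIT, the admissibility of the hit
conjugate constituent, the two stability twins) and Layer B (`wall_of_L1_data`: the wall's conclusion on any plane from
the §15 displays)

Blind re-derivation cell `pub-hodge-repro`, Tier 4 «prove the step» (README §9–§10).  Seat t4-plan-4 (gen 4) wrote the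
assembly `work/v33/Assembly-v33.lean` (d979ecf30f9f712a · 666; S14857); seat t4-L4-p1 (gen 4) files it on the planner's
word in TWO modules because the gate's ≤ 400-line lint for files with proofs forbids the single one — every declaration
below is BYTE-IDENTICAL to the assembly's (Layers A and B, lines 376–662 there); Parts A and C are `Tier4/Line4/L1Class.lean`
(imported).  The planner's header docstring (the design of (7′)/(8′), Layer A, Layer B and the v2 precisions) is in that
file.  Everything below `sorry`-free; the displays are the `def … : Prop`s / structures of `L1Class` and the binders of
`wall_of_L1_data`.
Nothing here says anything about the status of the Hodge conjecture for CM abelian varieties, which is NOT proved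
(HC_CM is NOT proved by anyone in this repository).
-/

set_option autoImplicit false

noncomputable section
namespace Summit.Ventures.HodgeRepro.Tier4.Line4.L1Class

open MeasureTheory Topology NumberField Summit.Ventures.HodgeRepro.Tier4.Common
  Summit.Ventures.HodgeRepro.Tier4.Line1 Summit.Ventures.HodgeRepro.Tier4.Line1.RTF

open scoped Pointwise

/-! ## Layer A — the `L¹` twin of 2VEC-HIT and the admissibility of the hit conjugate constituent -/

section LayerA

open scoped ComplexConjugate

variable {k : Type} [Field k] [NumberField k] (W : PlaneData k) [MeasurableSpace (GA W)] [BorelSpace (GA W)]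
  (R : RTFData W) (μ : Measure (GA W)) [μ.IsHaarMeasure] [R.μT.IsHaarMeasure] [R.μT'.IsHaarMeasure]
  (DG : Set (GA W)) (fdG : IsFundamentalDomain (rationalPoints W) DG μ) (compG : IsCompact (closure DG))
  (compT : IsCompact (closure R.DT)) (compT' : IsCompact (closure R.DT'))

/-- **2VEC-HIT for an `L¹` first test** (proved; `mixed_two_torus_W3_twoVector_hit` with `h₁ : IsTestL1`, the spectral
side `RtfSpectralL1`, the closure `AdaptedClosedUnderL1` on the `f₁`-side, and `hJ` in the `S.J` form): some `j` with
`f̄₁` hitting `τ (n j)`, `conj (R(f₂ˇ) φ_j)` of non-zero `T′`-period and `conj (R(f̄₁) φ_j)` of non-zero `T`-period. -/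
theorem twoVector_hit_L1 (hc : Continuous R.chi) (hu : ∀ a, ‖R.chi a‖ = 1)
    (hc' : Continuous R.chi') (hunit' : ∀ t, ‖R.chi' t‖ = 1)
    {τ : ℕ → Set (GA W → ℂ)} {φ : ℕ → GA W → ℂ} {n : ℕ → ℕ}
    (hB : (Setting.ofAdelicData W R μ DG fdG compG compT compT').IsAdaptedONB τ φ n)
    (hspec : RtfSpectralL1 (Setting.ofAdelicData W R μ DG fdG compG compT compT'))
    (hcl : AdaptedClosedUnderL1 (Setting.ofAdelicData W R μ DG fdG compG compT compT') τ)
    {f₁ f₂ : GA W → ℂ} (h₁ : IsTestL1 (Setting.ofAdelicData W R μ DG fdG compG compT compT') f₁)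
    (h₂ : IsTestFn W f₂)
    (hJ : (Setting.ofAdelicData W R μ DG fdG compG compT compT').J R.chi R.chi'
      ((Setting.ofAdelicData W R μ DG fdG compG compT compT').conv f₁ f₂) ≠ 0) :
    ∃ j : ℕ, (Setting.ofAdelicData W R μ DG fdG compG compT compT').Hit (RTF.cj f₁) (τ (n j)) ∧
      periodLin W R.μT' R.DT' R.chi'
        (restrictTo W (torusT' W) fun x => conj (rightRegular W μ (RTF.refl f₂) (φ j) x)) ≠ 0 ∧
      periodLin W R.μT R.DT R.chi
        (restrictTo W (torusT W) fun x => conj (rightRegular W μ (RTF.cj f₁) (φ j) x)) ≠ 0 := by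
  set S := Setting.ofAdelicData W R μ DG fdG compG compT compT' with hS
  have h₂' : RTF.IsTest f₂ := ⟨h₂.1, h₂.2⟩
  -- a non-zero spectral term, from the `L¹` spectral expansion
  obtain ⟨j, hterm⟩ := exists_term_ne_zero
    (hspec R.chi R.chi' (isCharacter_chi W R μ DG fdG compG compT compT' hc hu)
      (isCharacter'_chi' W R μ DG fdG compG compT compT' hc' hunit') τ φ n hB f₁ f₂ h₁ h₂') hJ
  -- the two factors
  have hterm' := hterm
  unfold RTF.Setting.specTerm at hterm'
  have hP' : S.periodT' R.chi' (fun t' => S.R (RTF.refl f₂) (φ j) t') ≠ 0 := left_ne_zero_of_mul hterm'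
  have hP : conj (S.periodT R.chi (fun t => S.R (RTF.cj f₁) (φ j) t)) ≠ 0 := right_ne_zero_of_mul hterm'
  -- the hit constituent
  have hhit : S.Hit (RTF.cj f₁) (τ (n j)) := (atoms_L1 S hB hcl h₁ h₂' j hterm).2.2
  -- continuity of the two vectors
  have hc₁ : Continuous (S.R (RTF.cj f₁) (φ j)) :=
    (hB.inv (n j)).cont _ (hcl (n j) (φ j) (hB.mem j) _ (h₁.cj S))
  have hc₂ : Continuous (S.R (RTF.refl f₂) (φ j)) :=
    (hB.inv (n j)).cont _ ((hB.inv (n j)).conv (φ j) (hB.mem j) _ h₂'.refl)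
  refine ⟨j, hhit, ?_, ?_⟩
  · rw [← R_ofAdelicData_eq W R μ DG fdG compG compT compT',
      periodLin_chi'_conj_eq W R μ DG fdG compG compT compT' hc' hc₂]
    intro h0
    apply hP'
    have := congrArg conj h0
    rw [Complex.conj_conj, map_zero] at this
    exact this
  · rw [← R_ofAdelicData_eq W R μ DG fdG compG compT compT',
      periodLin_chi_conj_eq W R μ DG fdG compG compT compT' hc hc₁]
    exact hP

/-- **the technical inputs of KTYPE (4)/(6)** (KTypeOfPeriodClosed p694119 `hasKTypeAt_of_period_ne_zero_span` and its
primed twin), bundled: compact local tori carrying Haar probability measures, right-invariant toric Haar measures, the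
weight characters multiplicative, continuous and unitary on the local tori, and the characters `χ`, `χ′` matching the
weights at every infinite place (the wall's `_hchi`, `_hchi'`). -/
structure KTypeData (q : QuadData k) (g g' : Matrix (Fin 4) (Fin 4) k) (eP eM eP' eM' : InfinitePlace k → ℤ) :
    Prop where
  rightT : R.μT.IsMulRightInvariant
  rightT' : R.μT'.IsMulRightInvariant
  compactT : ∀ w, CompactSpace (localTorusAt W w)
  compactT' : ∀ w, CompactSpace (localTorusAt' W w)
  measT : ∀ w, ∃ ν : Measure (localTorusAt W w), ν.IsHaarMeasure ∧ IsProbabilityMeasure ν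
  measT' : ∀ w, ∃ ν : Measure (localTorusAt' W w), ν.IsHaarMeasure ∧ IsProbabilityMeasure ν
  mulT : ∀ w, ∀ a ∈ localTorusAt W w, ∀ b ∈ localTorusAt W w,
    weightAt W q w 0 (a * b) ^ eP w * weightAt W q w 1 (a * b) ^ eM w =
      (weightAt W q w 0 a ^ eP w * weightAt W q w 1 a ^ eM w) *
        (weightAt W q w 0 b ^ eP w * weightAt W q w 1 b ^ eM w)
  contT : ∀ w, Continuous fun κ : localTorusAt W w => weightAt W q w 0 κ ^ eP w * weightAt W q w 1 κ ^ eM w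
  unitT : ∀ w, ∀ κ : localTorusAt W w, ‖weightAt W q w 0 κ ^ eP w * weightAt W q w 1 κ ^ eM w‖ = 1
  matchT : ∀ w, ChiMatchesAt W q w (eP w) (eM w) R.chi
  mulT' : ∀ w, ∀ a ∈ localTorusAt' W w, ∀ b ∈ localTorusAt' W w,
    weightAt' W q w g g' 0 (a * b) ^ eP' w * weightAt' W q w g g' 1 (a * b) ^ eM' w =
      (weightAt' W q w g g' 0 a ^ eP' w * weightAt' W q w g g' 1 a ^ eM' w) *
        (weightAt' W q w g g' 0 b ^ eP' w * weightAt' W q w g g' 1 b ^ eM' w)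
  contT' : ∀ w, Continuous fun κ : localTorusAt' W w =>
    weightAt' W q w g g' 0 κ ^ eP' w * weightAt' W q w g g' 1 κ ^ eM' w
  unitT' : ∀ w, ∀ κ : localTorusAt' W w, ‖weightAt' W q w g g' 0 κ ^ eP' w * weightAt' W q w g g' 1 κ ^ eM' w‖ = 1
  matchT' : ∀ w, ChiMatchesAt' W q w g g' (eP' w) (eM' w) R.chi'

/-- **ADMISSIBILITY OF THE HIT CONJUGATE CONSTITUENT** (proved; the (d)-plate assembled): `span ℂ (conj '' τ m)` is
`IsAdmissibleS` from (1)/(2) the adapted family (ADM135), (3) anisotropy (`isCuspidalSubspace_of_isAnisotropic`),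
(4)/(6) a vector of it with non-zero `T`-period resp. `T′`-period (KTYPE at every place), (5)/(7) the pseudo-coefficient
displays on `cj f₁` and the hit (LOWEST). -/
theorem isAdmissibleS_span_conj_of_periods (hc : Continuous R.chi) (hu : ∀ a, ‖R.chi a‖ = 1)
    (hc' : Continuous R.chi') (hunit' : ∀ t, ‖R.chi' t‖ = 1) (hA : IsAnisotropic W)
    (q : QuadData k) (g g' : Matrix (Fin 4) (Fin 4) k) (w₀ : InfinitePlace k)
    (eP eM eP' eM' : InfinitePlace k → ℤ) (D : KTypeData W R q g g' eP eM eP' eM')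
    {τ : ℕ → Set (GA W → ℂ)} {φ : ℕ → GA W → ℂ} {n : ℕ → ℕ}
    (hB : (Setting.ofAdelicData W R μ DG fdG compG compT compT').IsAdaptedONB τ φ n) {m : ℕ}
    (hτcl : IsClosedSub (Setting.ofAdelicData W R μ DG fdG compG compT compT') (τ m))
    {f₁ : GA W → ℂ}
    (hpc : IsPseudoCoeffAt W (Setting.ofAdelicData W R μ DG fdG compG compT compT') q w₀ eP eM (RTF.cj f₁))
    (hpc' : IsPseudoCoeffAt' W (Setting.ofAdelicData W R μ DG fdG compG compT compT') q g g' w₀ eP' eM' (RTF.cj f₁))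
    (hhit : (Setting.ofAdelicData W R μ DG fdG compG compT compT').Hit (RTF.cj f₁) (τ m))
    {v v' : GA W → ℂ}
    (hv : v ∈ Submodule.span ℂ ((fun ψ : GA W → ℂ => fun x => conj (ψ x)) '' τ m))
    (hPv : periodLin W R.μT R.DT R.chi (restrictTo W (torusT W) v) ≠ 0)
    (hv' : v' ∈ Submodule.span ℂ ((fun ψ : GA W → ℂ => fun x => conj (ψ x)) '' τ m))
    (hPv' : periodLin W R.μT' R.DT' R.chi' (restrictTo W (torusT' W) v') ≠ 0) :
    IsAdmissibleS W (Setting.ofAdelicData W R μ DG fdG compG compT compT') q g g' w₀ eP eM eP' eM'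
      (Submodule.span ℂ ((fun ψ : GA W → ℂ => fun x => conj (ψ x)) '' τ m)) := by
  set S := Setting.ofAdelicData W R μ DG fdG compG compT compT' with hS
  have hU : S.IsInvariantSubspace ((fun ψ : GA W → ℂ => fun x => conj (ψ x)) '' τ m) :=
    isInvariantSubspace_conj S (hB.inv m)
  have hUcl : IsClosedSub S ((fun ψ : GA W → ℂ => fun x => conj (ψ x)) '' τ m) := isClosedSub_conj S hτcl
  haveI := D.rightT
  haveI := D.rightT'
  refine ⟨isInvariantSubspace_span_conj_of_adapted W R μ DG fdG compG compT compT' hB m,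
    isIrreducible_span_conj_of_adapted W R μ DG fdG compG compT compT' hB m,
    isCuspidalSubspace_of_isAnisotropic hA _, ?_,
    not_hasKTypeAt_span_conj_of_hit W R μ DG fdG compG compT compT' hB hτcl q w₀ eP eM hpc hhit, ?_,
    not_hasKTypeAt'_span_conj_of_hit W R μ DG fdG compG compT compT' hB hτcl q g g' w₀ eP' eM' hpc' hhit⟩
  · intro w
    haveI := D.compactT w
    obtain ⟨ν, hνH, hνP⟩ := D.measT w
    exact hasKTypeAt_of_period_ne_zero_span W R μ DG fdG compG compT compT' w q eP eM ν hu hc (D.mulT w)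
      (D.contT w) (D.unitT w) (D.matchT w) hU hUcl hv hPv
  · intro w
    haveI := D.compactT' w
    obtain ⟨ν, hνH, hνP⟩ := D.measT' w
    exact hasKTypeAt'_of_period_ne_zero_span W R μ DG fdG compG compT compT' w q eP' eM' g g' ν hunit' hc'
      (D.mulT' w) (D.contT' w) (D.unitT' w) (D.matchT' w) hU hUcl hv' hPv'

/-- **STABILITY for an `L¹` first test, read on `cj f₁`** (proved; `rightRegular_mem_kTypeSpace'` at `(−eP′, −eM′)` with
its `IsInvariantSubspace.conv` clause replaced by `AdaptedClosedUnderL1`, then `mem_kTypeSpace'_conj`): from the left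
`(T′, −e′)`-equivariance and the left `K`-invariance of `cj f₁`, `conj (R(f̄₁) φ_j) ∈ kTypeSpace' … eP′ eM′ K (span (conj '' τ (n j)))`. -/
theorem hst₁_L1 (q : QuadData k) (g g' : Matrix (Fin 4) (Fin 4) k) (eP' eM' : InfinitePlace k → ℤ)
    (K : Subgroup (GA W))
    (hnorm : ∀ (w : InfinitePlace k) (κ : GA W), κ ∈ localTorusAt' W w →
      ∀ j : Fin 2, ‖weightAt' W q w g g' j κ‖ = 1)
    {τ : ℕ → Set (GA W → ℂ)} {φ : ℕ → GA W → ℂ} {n : ℕ → ℕ}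
    (hB : (Setting.ofAdelicData W R μ DG fdG compG compT compT').IsAdaptedONB τ φ n)
    (hcl : AdaptedClosedUnderL1 (Setting.ofAdelicData W R μ DG fdG compG compT compT') τ)
    {f₁ : GA W → ℂ} (h₁ : IsTestL1 (Setting.ofAdelicData W R μ DG fdG compG compT compT') f₁)
    (hfT' : ∀ (w : InfinitePlace k) (κ : GA W), κ ∈ localTorusAt' W w → ∀ y,
      RTF.cj f₁ (κ⁻¹ * y) =
        weightAt' W q w g g' 0 κ ^ (-eP' w) * weightAt' W q w g g' 1 κ ^ (-eM' w) * RTF.cj f₁ y)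
    (hfK : ∀ κ ∈ K, ∀ y, RTF.cj f₁ (κ⁻¹ * y) = RTF.cj f₁ y) (j : ℕ) :
    (fun x => conj (rightRegular W μ (RTF.cj f₁) (φ j) x)) ∈
      kTypeSpace' W q g g' eP' eM' K
        (Submodule.span ℂ ((fun ψ : GA W → ℂ => fun x => conj (ψ x)) '' τ (n j))) := by
  set S := Setting.ofAdelicData W R μ DG fdG compG compT compT' with hS
  have hmem : S.R (RTF.cj f₁) (φ j) ∈ τ (n j) := hcl (n j) (φ j) (hB.mem j) _ (h₁.cj S)
  have hdirect : rightRegular W μ (RTF.cj f₁) (φ j) ∈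
      kTypeSpace' W q g g' (-eP') (-eM') K (Submodule.span ℂ (τ (n j))) := by
    refine ⟨Submodule.subset_span hmem, fun w x κ hκ => ?_, fun x κ hκ => ?_⟩
    · exact rightRegular_apply_mul_of_left_equivariant W μ (RTF.cj f₁) (φ j) x κ _ (hfT' w κ hκ)
    · have := rightRegular_apply_mul_of_left_equivariant W μ (RTF.cj f₁) (φ j) x κ 1
        (fun y => by rw [hfK κ hκ y, one_mul])
      rw [this, one_mul]
  refine mem_kTypeSpace'_conj W q g g' eP' eM' K hnorm hdirect ?_
  exact Submodule.subset_span ⟨rightRegular W μ (RTF.cj f₁) (φ j), hmem, rfl⟩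

/-- **STABILITY for the second test, read on `refl f₂`** (proved; the compactly supported side is the tree's
`rightRegular_mem_kTypeSpace'` + `mem_kTypeSpace'_conj`). -/
theorem hst₂_L1 (q : QuadData k) (g g' : Matrix (Fin 4) (Fin 4) k) (eP' eM' : InfinitePlace k → ℤ)
    (K : Subgroup (GA W))
    (hnorm : ∀ (w : InfinitePlace k) (κ : GA W), κ ∈ localTorusAt' W w →
      ∀ j : Fin 2, ‖weightAt' W q w g g' j κ‖ = 1)
    {τ : ℕ → Set (GA W → ℂ)} {φ : ℕ → GA W → ℂ} {n : ℕ → ℕ}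
    (hB : (Setting.ofAdelicData W R μ DG fdG compG compT compT').IsAdaptedONB τ φ n)
    {f₂ : GA W → ℂ} (h₂ : IsTestFn W f₂)
    (hfT' : ∀ (w : InfinitePlace k) (κ : GA W), κ ∈ localTorusAt' W w → ∀ y,
      RTF.refl f₂ (κ⁻¹ * y) =
        weightAt' W q w g g' 0 κ ^ (-eP' w) * weightAt' W q w g g' 1 κ ^ (-eM' w) * RTF.refl f₂ y)
    (hfK : ∀ κ ∈ K, ∀ y, RTF.refl f₂ (κ⁻¹ * y) = RTF.refl f₂ y) (j : ℕ) :
    (fun x => conj (rightRegular W μ (RTF.refl f₂) (φ j) x)) ∈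
      kTypeSpace' W q g g' eP' eM' K
        (Submodule.span ℂ ((fun ψ : GA W → ℂ => fun x => conj (ψ x)) '' τ (n j))) := by
  set S := Setting.ofAdelicData W R μ DG fdG compG compT compT' with hS
  have h₂' : RTF.IsTest f₂ := ⟨h₂.1, h₂.2⟩
  have hmem : S.R (RTF.refl f₂) (φ j) ∈ τ (n j) := (hB.inv (n j)).conv (φ j) (hB.mem j) _ h₂'.refl
  have hdirect : rightRegular W μ (RTF.refl f₂) (φ j) ∈
      kTypeSpace' W q g g' (-eP') (-eM') K (Submodule.span ℂ (τ (n j))) := by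
    refine ⟨Submodule.subset_span hmem, fun w x κ hκ => ?_, fun x κ hκ => ?_⟩
    · exact rightRegular_apply_mul_of_left_equivariant W μ (RTF.refl f₂) (φ j) x κ _ (hfT' w κ hκ)
    · have := rightRegular_apply_mul_of_left_equivariant W μ (RTF.refl f₂) (φ j) x κ 1
        (fun y => by rw [hfK κ hκ y, one_mul])
      rw [this, one_mul]
  refine mem_kTypeSpace'_conj W q g g' eP' eM' K hnorm hdirect ?_
  exact Submodule.subset_span ⟨rightRegular W μ (RTF.refl f₂) (φ j), hmem, rfl⟩

end LayerA

/-! ## Layer B — the wall's conclusion on any plane from the §15 displays -/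

section LayerB

open scoped ComplexConjugate

variable {k : Type} [Field k] [NumberField k] (W : PlaneData k) [MeasurableSpace (GA W)] [BorelSpace (GA W)]
  (R : RTFData W) (μ : Measure (GA W)) [μ.IsHaarMeasure] [R.μT.IsHaarMeasure] [R.μT'.IsHaarMeasure]
  (DG : Set (GA W)) (fdG : IsFundamentalDomain (rationalPoints W) DG μ) (compG : IsCompact (closure DG))
  (compT : IsCompact (closure R.DT)) (compT' : IsCompact (closure R.DT'))

/-- **C-L4-TAIL — the display consumed by the assembly**: for EVERY archimedean coefficient (in particular D3COEFF's)
there is a level family (`TailFamily`) dominated from some level on (`LevelTailDominated`), for the characters of `R`. -/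
def TailForArch (q : QuadData k) (g g' : Matrix (Fin 4) (Fin 4) k) (w₀ : InfinitePlace k)
    (eP eM eP' eM' : InfinitePlace k → ℤ) (γ₀ : GA W)
    (o₀ : (Setting.ofAdelicData W R μ DG fdG compG compT compT').Orbit)
    (νinf : Measure (torusInf W)) (νinf' : Measure (torusInf' W)) : Prop :=
  ∀ finf : GA W → ℂ,
    IsArchCoeff W (Setting.ofAdelicData W R μ DG fdG compG compT compT') R q g g' w₀ eP eM eP' eM' γ₀ νinf νinf' finf →
    ∃ ffin f₂ : ℕ → GA W → ℂ, TailFamily W q g g' eP' eM' ffin f₂ ∧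
      LevelTailDominated W (Setting.ofAdelicData W R μ DG fdG compG compT compT') R.chi R.chi' o₀ finf ffin f₂

/-- **THE WALL FROM THE §15 DISPLAYS** (proved, sorry-free): on ANY plane `W` with RTF data, the conclusion of
`mixed_two_torus_W3` follows from C-L1-L1RTF (`RtfSpectralL1`, `RtfGeometricL1`, `PoincareOfConv` in the (α) form), C-L4-L1CLOSED (`AdaptedClosedUnderL1`), C-L4-D3COEFF (`D3CoeffData`), C-L4-TAIL (`TailForArch`), the
closedness of the constituents, anisotropy (the residual S14625), the unit weights `hnorm` and the KTYPE technical data.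
The proof: D3COEFF's `finf` → TAIL's family at the level `N := max N₀ 1` → `J ≠ 0` (`J_ne_zero_of_tailDominated`) →
`twoVector_hit_L1` → the two stability twins at `K := K(N)` → `isAdmissibleS_span_conj_of_periods`. -/
theorem wall_of_L1_data (hc : Continuous R.chi) (hu : ∀ a, ‖R.chi a‖ = 1)
    (hc' : Continuous R.chi') (hunit' : ∀ t, ‖R.chi' t‖ = 1) (hA : IsAnisotropic W)
    (q : QuadData k) (g g' : Matrix (Fin 4) (Fin 4) k) (w₀ : InfinitePlace k)
    (eP eM eP' eM' : InfinitePlace k → ℤ)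
    (hnorm : ∀ (w : InfinitePlace k) (κ : GA W), κ ∈ localTorusAt' W w →
      ∀ j : Fin 2, ‖weightAt' W q w g g' j κ‖ = 1)
    (D : KTypeData W R q g g' eP eM eP' eM')
    {τ : ℕ → Set (GA W → ℂ)} {φ : ℕ → GA W → ℂ} {n : ℕ → ℕ}
    (hB : (Setting.ofAdelicData W R μ DG fdG compG compT compT').IsAdaptedONB τ φ n)
    (hτcl : ∀ m, IsClosedSub (Setting.ofAdelicData W R μ DG fdG compG compT compT') (τ m))
    (hspec : RtfSpectralL1 (Setting.ofAdelicData W R μ DG fdG compG compT compT'))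
    (hgeo : RtfGeometricL1 (Setting.ofAdelicData W R μ DG fdG compG compT compT'))
    (hPc : PoincareOfConv (Setting.ofAdelicData W R μ DG fdG compG compT compT'))
    (hcl : AdaptedClosedUnderL1 (Setting.ofAdelicData W R μ DG fdG compG compT compT') τ)
    (γ₀ : GA W) (o₀ : (Setting.ofAdelicData W R μ DG fdG compG compT compT').Orbit)
    (νinf : Measure (torusInf W)) (νinf' : Measure (torusInf' W))
    (hD3 : D3CoeffData W (Setting.ofAdelicData W R μ DG fdG compG compT compT') R q g g' w₀ eP eM eP' eM' γ₀ νinf νinf')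
    (htail : TailForArch W R μ DG fdG compG compT compT' q g g' w₀ eP eM eP' eM' γ₀ o₀ νinf νinf') :
    ∃ V : Submodule ℂ (GA W → ℂ),
      IsAdmissibleS W (Setting.ofAdelicData W R μ DG fdG compG compT compT') q g g' w₀ eP eM eP' eM' V ∧
      ∃ K : Subgroup (GA W), IsCompactOpenIn W (finitePart W) K ∧
        (∃ f ∈ kTypeSpace' W q g g' eP' eM' K V,
          periodLin W R.μT' R.DT' R.chi' (restrictTo W (torusT' W) f) ≠ 0) ∧
        ∃ f ∈ kTypeSpace' W q g g' eP' eM' K V,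
          periodLin W R.μT R.DT R.chi (restrictTo W (torusT W) f) ≠ 0 := by
  set S := Setting.ofAdelicData W R μ DG fdG compG compT compT' with hS
  have hχ : S.IsCharacter R.chi := isCharacter_chi W R μ DG fdG compG compT compT' hc hu
  have hχ' : S.IsCharacter' R.chi' := isCharacter'_chi' W R μ DG fdG compG compT compT' hc' hunit'
  -- D3COEFF: the archimedean coefficient; TAIL: its level family, dominated from `N₀` on
  obtain ⟨finf, hfinf⟩ := hD3
  obtain ⟨ffin, f₂, hfam, N₀, hN₀⟩ := htail finf hfinf
  -- the level `N := max N₀ 1`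
  set N : ℕ := max N₀ 1 with hNdef
  have hN1 : N ≠ 0 := by
    have : 1 ≤ N := le_max_right _ _
    omega
  have hT := hN₀ N (le_max_left _ _)
  -- the test pair at level `N`
  set f₁ : GA W → ℂ := prodFn W finf (ffin N) with hf₁
  have h₁ : IsTestL1 S f₁ := ⟨continuous_prodFn W hfinf.cont (hfam.fin N).cont, hfinf.integrable _ (hfam.fin N)⟩
  have h₂ : IsTestFn W (f₂ N) := hfam.test₂ N
  have h₂' : RTF.IsTest (f₂ N) := ⟨h₂.1, h₂.2⟩
  -- the one number: `J(f₁ ⋆ f₂) ≠ 0` from the dominated `o₀`-term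
  haveI := secondCountable_GA W
  haveI := sigmaCompact_GA W
  haveI := locallyCompactSpace_GA W
  haveI : SFinite S.μ := inferInstanceAs (SFinite μ)
  have hJ : S.J R.chi R.chi' (S.conv f₁ (f₂ N)) ≠ 0 :=
    J_ne_zero_of_tailDominated S hgeo hχ hχ' (isTestL1_conv S h₁ h₂') (hPc f₁ (f₂ N) h₁ h₂') hT
  -- the hit constituent and its two vectors
  obtain ⟨j, hhit, hper', hper⟩ :=
    twoVector_hit_L1 W R μ DG fdG compG compT compT' hc hu hc' hunit' hB hspec hcl h₁ h₂ hJ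
  -- the level `K := K(N)` and the two stability clauses
  set K : Subgroup (GA W) := levelK W N with hKdef
  have hK : IsCompactOpenIn W (finitePart W) K := isCompactOpenIn_levelK W hN1
  have hst₁ := hst₁_L1 W R μ DG fdG compG compT compT' q g g' eP' eM' K hnorm hB hcl h₁
    (fun w κ hκ y => cj_prodFn_equiv W q g g' eP' eM' hfinf.equiv (ffin N) w κ hκ y)
    (fun κ hκ y => cj_prodFn_levelInv W N (hfam.leftInv N) κ hκ y) j
  have hst₂ := hst₂_L1 W R μ DG fdG compG compT compT' q g g' eP' eM' K hnorm hB h₂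
    (fun w κ hκ y => refl_equiv W q g g' eP' eM' (hfam.equiv₂ N) w κ hκ y)
    (fun κ hκ y => refl_levelInv W K (hfam.rightInv₂ N) κ hκ y) j
  refine ⟨Submodule.span ℂ ((fun ψ : GA W → ℂ => fun x => conj (ψ x)) '' τ (n j)), ?_, K, hK,
    ⟨_, hst₂, hper'⟩, ⟨_, hst₁, hper⟩⟩
  exact isAdmissibleS_span_conj_of_periods W R μ DG fdG compG compT compT' hc hu hc' hunit' hA q g g' w₀ eP eM
    eP' eM' D hB (hτcl (n j)) (hfinf.pseudo _ (hfam.fin N)) (hfinf.pseudo' _ (hfam.fin N)) hhit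
    (kTypeSpace'_le W q g g' eP' eM' K _ hst₁) hper (kTypeSpace'_le W q g g' eP' eM' K _ hst₂) hper'

end LayerB

end Summit.Ventures.HodgeRepro.Tier4.Line4.L1Class

end
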